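import Mathlib
import Summits.Parity.BatemanHorn.Theses.SelbergDelangeRigidity
import Literature.NumberTheory.LFunctions.DeterminantEquationDFI

/-!
# Sketch — crux-ideate stmt-Parity-9770 (LSDRealSegment), ideator 3, round 1

First-lemma signatures for the two idea cards `cheap-patterns-smooth-moduli` and
`twin-three-regime-map`.  Nothing is proved here; every `def` is a `Prop` over existing declarations.
-/

open Filter Finset
open scoped BigOperators Topology Classical

namespace Summit.Parity.BatemanHorn.Cruxes.LSDRealSegment.Ideator3

/-- Card `cheap-patterns-smooth-moduli`, first lemma (a) — THIN CLASSES for a quadratic member with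
the UNCAPPED statistic `Ω`: the `y`-tilted mass of the top class (a prime factor `> x^{2-η}`) together
with the balanced-semiprime class (two distinct prime factors `> x^{1-η}`) is `≤ ε x (log x)^{y-1}`
once `η ≤ η(ε)`.  (Upper-bound sieve of the right order, Nair–Tenenbaum / Selberg type; no asymptotics.) -/
def QuadraticThinClasses (g : Polynomial ℤ) : Prop :=
  g.natDegree = 2 → Literature.NumberTheory.Sieve.IsBatemanHornSystem ![g] →
    ∀ y : ℝ, 1 ≤ y → y ≤ 2 → ∀ ε : ℝ, 0 < ε → ∃ η : ℝ, 0 < η ∧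
      ∀ᶠ x : ℕ in atTop,
        (∑ n ∈ (Finset.range (x + 1)).filter (fun n : ℕ =>
            (∃ p : ℕ, p.Prime ∧ (p : ℤ) ∣ g.eval (n : ℤ) ∧ (x : ℝ) ^ (2 - η) < p) ∨
            (∃ p q : ℕ, p.Prime ∧ q.Prime ∧ p ≠ q ∧ ((p * q : ℕ) : ℤ) ∣ g.eval (n : ℤ) ∧
              (x : ℝ) ^ (1 - η) < p ∧ (x : ℝ) ^ (1 - η) < q)),
          y ^ (ArithmeticFunction.cardFactors ((g.eval (n : ℤ)).toNat)))
        ≤ ε * x * Real.log x ^ (y - 1)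

/-- Card `cheap-patterns-smooth-moduli`, first lemma (b) — the simplest CHEAP pattern beyond level 1
for `X²+1`: `r` primes in ONE dyadic box `(x^{θ/r}, 2x^{θ/r}]`, total level `θ ∈ (1,2)`, box below the
smoothness line `θ/r ≤ 2 - θ` (so the modulus `∏ S ~ x^θ` is `x^{2-θ}`-smooth): the number of
`n ≤ x` with `∏ S ∣ n²+1`, summed over the `r`-subsets `S`, is asymptotic to its local-density
prediction `(x+1) Σ_S ∏_{p∈S} ρ(p)/p`.  For `r = 2`, `θ = 1+δ` this is the main-term shadow of
`GaussianFractions.RootFractionsBound`; the whole family over `(θ, r)` with `θ ≤ 2r/(r+1)` is the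
open input of the line for the quadratic member. -/
def EqualBoxRootCount (θ : ℝ) (r : ℕ) : Prop :=
  1 < θ → θ < 2 → θ / r ≤ 2 - θ →
    Tendsto (fun x : ℕ =>
      (∑ S ∈ (((Finset.Ioc ⌊(x : ℝ) ^ (θ / r)⌋₊ ⌊2 * (x : ℝ) ^ (θ / r)⌋₊).filter Nat.Prime).powersetCard r),
          ((((Finset.range (x + 1)).filter (fun n : ℕ => ((∏ p ∈ S, p : ℕ) : ℤ) ∣ (n : ℤ) ^ 2 + 1)).card : ℕ) : ℝ)) /
      (((x : ℝ) + 1) * ∑ S ∈ (((Finset.Ioc ⌊(x : ℝ) ^ (θ / r)⌋₊ ⌊2 * (x : ℝ) ^ (θ / r)⌋₊).filter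
            Nat.Prime).powersetCard r),
          ∏ p ∈ S, ((Literature.NumberTheory.Sieve.polyRootCountMod
              ![(Polynomial.X ^ 2 + 1 : Polynomial ℤ)] p : ℕ) : ℝ) / p))
      atTop (𝓝 1)

/-- Card `twin-three-regime-map`, first lemma (a) — the BALANCED cheap pattern of the twin member
`(X, X+2)` at level `θ ∈ (1, 4/3]`: `n` has two prime factors in the box `(x^{θ/4}, 2x^{θ/4}]` and
`n+2` has two prime factors in the same box (so `d₁ ∣ n`, `d₂ ∣ n+2` with `d₁ d₂ ~ x^θ > x`,
`d₁ ≈ d₂ ≈ x^{θ/2}`): the count is asymptotic to `x Σ 1/(d₁d₂)`.  In print for `θ < 1 + 1/95`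
(pointwise DFI 1997, in-tree fact) and `θ < 40/39` (Bettin–Chandee with the frequency block as third
variable); OPEN above, equivalent to balanced bilinear Kloosterman-fraction bounds with saving
`(MN)^{1-1/θ}`. -/
def TwinTwoByTwo (θ : ℝ) : Prop :=
  1 < θ → θ ≤ 4 / 3 →
    Tendsto (fun x : ℕ =>
      (∑ S ∈ (((Finset.Ioc ⌊(x : ℝ) ^ (θ / 4)⌋₊ ⌊2 * (x : ℝ) ^ (θ / 4)⌋₊).filter Nat.Prime).powersetCard 2),
        ∑ T ∈ (((Finset.Ioc ⌊(x : ℝ) ^ (θ / 4)⌋₊ ⌊2 * (x : ℝ) ^ (θ / 4)⌋₊).filter Nat.Prime).powersetCard 2),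
          ((((Finset.Icc 1 x).filter (fun n : ℕ => (∏ p ∈ S, p) ∣ n ∧ (∏ q ∈ T, q) ∣ n + 2)).card : ℕ) : ℝ)) /
      ((x : ℝ) * ∑ S ∈ (((Finset.Ioc ⌊(x : ℝ) ^ (θ / 4)⌋₊ ⌊2 * (x : ℝ) ^ (θ / 4)⌋₊).filter
            Nat.Prime).powersetCard 2),
        ∑ T ∈ (((Finset.Ioc ⌊(x : ℝ) ^ (θ / 4)⌋₊ ⌊2 * (x : ℝ) ^ (θ / 4)⌋₊).filter Nat.Prime).powersetCard 2),
          (1 : ℝ) / ((∏ p ∈ S, (p : ℝ)) * ∏ q ∈ T, (q : ℝ))))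
      atTop (𝓝 1)

/-- Card `twin-three-regime-map`, first lemma (b) — the ENGINE ladder: near-balanced bilinear
Kloosterman fractions at level `θ`, pointwise in the frequency `h` with `0 < |h| ≤ x^{θ-1+ε}`:
`|Σ_{m,n coprime} α_m β_n e(2h m̄/n)| ≤ x^{1-ε}` for `MN ∈ [x^θ/4, x^θ]`, `M, N ≤ x^{(2θ-1)/2}`,
1-bounded coefficients.  For `θ < 1 + 1/95` a COROLLARY of the in-tree fact
`Literature.NumberTheory.LFunctions.DukeFriedlanderIwaniec1997_bilinearKloostermanFractions`
(provable-now stub); DFI's conjectured optimal bound gives it up to `θ = 4/3`; nothing beyond. -/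
def TwinFractionBound (θ : ℝ) : Prop :=
  ∀ ε : ℝ, 0 < ε → ∃ x₀ : ℝ, ∀ x : ℝ, x₀ ≤ x → ∀ M N : ℝ, 1 ≤ M → 1 ≤ N →
    x ^ θ / 4 ≤ M * N → M * N ≤ x ^ θ → M ≤ x ^ ((2 * θ - 1) / 2) → N ≤ x ^ ((2 * θ - 1) / 2) →
    ∀ h : ℤ, h ≠ 0 → |(h : ℝ)| ≤ x ^ (θ - 1 + ε) → ∀ α β : ℕ → ℂ,
    (∀ m, ‖α m‖ ≤ 1) → (∀ n, ‖β n‖ ≤ 1) →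
      ‖∑ m ∈ Finset.Icc 1 ⌊2 * M⌋₊, ∑ n ∈ Finset.Icc 1 ⌊2 * N⌋₊,
          if Nat.Coprime m n then
            α m * β n * Complex.exp (2 * Real.pi * Complex.I *
              ((2 * h : ℂ) * ((((m : ZMod n)⁻¹).val : ℕ) : ℂ) / (n : ℂ)))
          else 0‖ ≤ x ^ (1 - ε)

/-- Sanity: the in-tree DFI 1997 fact is the object the twin ladder starts from. -/
example : Prop := Literature.NumberTheory.LFunctions.DukeFriedlanderIwaniec1997_bilinearKloostermanFractions

/-- Sanity: the crux decl this folder ideates on. -/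
example : Prop := Summit.Parity.BatemanHorn.Theses.SelbergDelangeRigidity.LSDRealSegment

end Summit.Parity.BatemanHorn.Cruxes.LSDRealSegment.Ideator3
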